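import Summits.BirchSwinnertonDyer.BirchSwinnertonDyer.Theorems.CyclotomicUntwistUntwistedNonvanishing
import Summits.BirchSwinnertonDyer.BirchSwinnertonDyer.Theorems.CyclotomicUntwistRohrlichAtLevel
import HarnessLib

/-!
# The untwisted `p`-adic `L`-function of D1 vanishes at only FINITELY MANY wild characters

Cell `pub/bsd-wall` (D-0145 line `route-BirchSwinnertonDyer-CyclotomicUntwist`), seat `bsd-line-cycu-p5`
(width seat 5), helper toward crux K1 `PSRankOneLowerHalfAtThree` (stmt-BirchSwinnertonDyer-21580), D1
currency. THEOREMS ONLY (no definition, no named fact, no `sorry`); BSD is not proved by this file and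
no crux is.

Strengthening of `CyclotomicUntwistUntwistedNonvanishingUnconditional` («some ball value of `𝓛^η` is
non-zero») to the cofinite statement Greenberg's arguments use («`L_p` has finitely many zeros at
`ζ_{pⁿ} − 1`»): with Rohrlich's theorem at a prime dividing the level
(`PSRohrlichAtLevel.rohrlich_primePow_of_coeffBound`, companion `CyclotomicUntwistRohrlichAtLevel`)
and D1's interpolation formula at conductor `pⁿ ≥ p^{2c}` with its NON-ZERO constants
(`PSUntwisting.gammaCharValue_eq_of_conductor_ge`: `∫_Γ ξ dμ = e_n(α) · η(−1) · g(η, ψ_χ) · ∑_a ξ(a)[a/pⁿ]⁺_f`;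
`e_n(α) = α^{-n} ≠ 0`, `g ≠ 0` by `PSPrimePowerGauss.gaussSum_ne_zero_of_isPrimitive`):

* `exists_ringHomComp_eq_padic` — every `ℂ_p`-valued Dirichlet character is the transport of a
  `ℚ̄`-valued one (counting; the `ℂ` version is `exists_ringHomComp_eq`);
* `gammaCharValue_eq_zero_iff` — under the D1 property (`η` primitive mod `p^c`, `c ≥ 1`, `α ≠ 0`),
  for `ξ` wild of conductor `pⁿ ≥ p^{2c}`: `∫_Γ ξ dμ = 0 ↔ ∑_a ξ(a)[a/pⁿ]⁺_f = 0`;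
* `exists_forall_gammaCharValue_ne_zero_of_coeffBound` — for a rational normalised newform with
  `|aₙ| ≤ C n^θ` (`θ < 2/3`), ANY prime `p`: **there is `n₀` such that `∫_Γ ξ dμ ≠ 0` for EVERY wild
  `ξ` (primitive, even, `p`-power order) of conductor `pⁿ`, `n ≥ n₀`** — transport `ℂ_p ← ℚ̄ → ℂ`,
  Birch's formula (`ratTwistedSymbolSum_mul_plusPeriod_holds`), and finiteness of the exceptional
  set; `exists_forall_gammaCharValue_ne_zero` for the newform of an elliptic curve;
* `exists_forall_gammaCharValue_ne_zero_of_isPSCyclotomicLFunctionOf` — the route's D1 object: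
  **`𝓛^η_W(ξ) ≠ 0` for all wild `ξ` of conductor `3ⁿ`, `n ≥ n₀(W, η)`** (unconditional).

References: R. Greenberg, *Iwasawa theory for elliptic curves*, LNM 1716 (1999), §1 (the use of
Rohrlich's theorem: `L_p ≠ 0`) ; D. E. Rohrlich, Invent. Math. 75 (1984) [cite: RohrlichInventiones1984, Theorem (p. 409)];
B. Mazur, J. Tate, J. Teitelbaum, Invent. Math. 84 (1986), §I.14 [cite: MazurTateTeitelbaum1986Invent, §I.14].
-/

noncomputable section

open scoped BigOperators

open CongruenceSubgroup DirichletCharacter Literature.NumberTheory.EllipticCurves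
  Literature.NumberTheory.EllipticCurves.ModularForms Literature.NumberTheory.IwasawaTheory
  Summit.BirchSwinnertonDyer.BirchSwinnertonDyer.Theorems.PSUntwisting
  Summit.BirchSwinnertonDyer.BirchSwinnertonDyer.Theorems.PSPrimePowerGauss
  Summit.BirchSwinnertonDyer.BirchSwinnertonDyer.Theorems.PSNonvanishingAtLevel
  Summit.BirchSwinnertonDyer.BirchSwinnertonDyer.Theorems.PSRohrlichAtLevel

-- single-conjunct summit: `Summit.BirchSwinnertonDyer.BirchSwinnertonDyer.…` repeats the name by design
set_option linter.dupNamespace false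
set_option autoImplicit false

namespace Summit.BirchSwinnertonDyer.BirchSwinnertonDyer.Theorems.PSUntwistNonvanishingCofinite

variable {p : ℕ} [Fact p.Prime]

/-! ### Transport of Dirichlet characters from `ℚ̄` to `ℂ_p` -/

/-- Every `ℂ_p`-valued Dirichlet character is the transport of a `ℚ̄`-valued one along any embedding
`ℚ̄ → ℂ_p` (both groups have `φ(n)` elements — `ℂ_p` is algebraically closed of characteristic `0` —
and the transport is injective); the `ℂ`-version is `exists_ringHomComp_eq`. [folklore] -/
theorem exists_ringHomComp_eq_padic (τ : AlgebraicClosure ℚ →+* ℂ_[p]) {n : ℕ} [NeZero n]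
    (χ : DirichletCharacter ℂ_[p] n) :
    ∃ ψ : DirichletCharacter (AlgebraicClosure ℚ) n, ψ.ringHomComp τ = χ := by
  classical
  letI := Fintype.ofFinite (DirichletCharacter (AlgebraicClosure ℚ) n)
  letI := Fintype.ofFinite (DirichletCharacter ℂ_[p] n)
  have hinj : Function.Injective (fun ψ : DirichletCharacter (AlgebraicClosure ℚ) n ↦
      ψ.ringHomComp τ) := MulChar.injective_ringHomComp τ.injective
  have hcard : Fintype.card (DirichletCharacter (AlgebraicClosure ℚ) n) =
      Fintype.card (DirichletCharacter ℂ_[p] n) := by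
    rw [← Nat.card_eq_fintype_card, ← Nat.card_eq_fintype_card,
      DirichletCharacter.card_eq_totient_of_hasEnoughRootsOfUnity,
      DirichletCharacter.card_eq_totient_of_hasEnoughRootsOfUnity]
  have hbij := (Fintype.bijective_iff_injective_and_card _).mpr ⟨hinj, hcard⟩
  exact hbij.2 χ

/-! ### `∫_Γ ξ dμ = 0 ↔ ∑ ξ(a)[a/pⁿ]⁺_f = 0` at conductors `pⁿ ≥ p^{2c}` -/

section Values

variable {N : ℕ} [NeZero N] {f : CuspForm (Gamma0 N) 2}
variable {c : ℕ} {η : DirichletCharacter ℂ_[p] (p ^ c)} {α : ℂ_[p]} {μ : (n : ℕ) → ZMod (p ^ n) → ℂ_[p]}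

/-- **The interpolation value vanishes iff the ordinary twisted symbol sum does.** Under the D1
property `IsUntwistedPAdicLFunction p f η α μ` with `η` primitive mod `p^c` (`c ≥ 1`) and `α ≠ 0`, for a
primitive even `ξ` mod `pⁿ` of `p`-power order with `n ≥ 2c`:
`∫_Γ ξ dμ = 0 ↔ ∑_{a mod pⁿ} ξ(a)[a/pⁿ]⁺_f = 0` — by `gammaCharValue_eq_of_conductor_ge`
(`∫_Γ ξ dμ = e_n(α)·η(−1)·g(η,ψ_χ)·∑ ξ(a)[a/pⁿ]⁺_f` at `χ = η̄↑·ξ`) whose three constants are non-zero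
(`untwistMultiplier_succ`, `η(−1)² = 1`, `gaussSum_ne_zero_of_isPrimitive` with
`isPrimitive_of_eq_untwistAddChar`). [cite: MazurTateTeitelbaum1986Invent, §I.14 (case p ∣ N)] -/
theorem gammaCharValue_eq_zero_iff (hμ : IsUntwistedPAdicLFunction p f η α μ) (hc : 0 < c)
    (hη : η.IsPrimitive) (hα : α ≠ 0) {n : ℕ} (hn : 2 * c ≤ n) (ξ : DirichletCharacter ℂ_[p] (p ^ n))
    (hξ : ξ.IsPrimitive) (hξe : ξ.Even) (hξo : ∃ j : ℕ, orderOf ξ = p ^ j) :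
    gammaCharValue p μ ξ = 0 ↔ ratTwistedSymbolSum f ξ = 0 := by
  have hcn : c < n := by omega
  set χ := changeLevel (pow_dvd_pow p hcn.le) η⁻¹ * ξ with hχ
  have hχprim : χ.IsPrimitive := isPrimitive_inv_changeLevel_mul η hcn ξ hξ
  have hcompat : ∀ a : ℕ, a.Coprime p →
      χ (a : ZMod (p ^ n)) = (η (a : ZMod (p ^ c)))⁻¹ * ξ (a : ZMod (p ^ n)) :=
    fun a ha ↦ inv_changeLevel_mul_apply_natCast η hc hcn.le ξ a ha
  obtain ⟨ψ, hψ⟩ := exists_addChar_eq χ hcn.le hn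
  have hval := gammaCharValue_eq_of_conductor_ge hμ hc hn ξ hξ hξe hξo χ hχprim hcompat ψ hψ
  have he : untwistMultiplier p α n ≠ 0 := by
    obtain ⟨m, rfl⟩ : ∃ m, n = m + 1 := ⟨n - 1, by omega⟩
    rw [untwistMultiplier_succ]
    exact pow_ne_zero _ (inv_ne_zero hα)
  have hη1 : η (-1) ≠ 0 := by
    have h : η (-1) * η (-1) = 1 := by rw [← map_mul, neg_mul_neg, one_mul, map_one]
    intro h'
    rw [h', zero_mul] at h
    exact zero_ne_one h
  have hG : gaussSum η ψ ≠ 0 :=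
    gaussSum_ne_zero_of_isPrimitive η hc hη (isPrimitive_of_eq_untwistAddChar hc hn χ hχprim ψ hψ)
  rw [hval]
  constructor
  · intro h
    rcases mul_eq_zero.mp h with h | h
    · exact absurd h he
    rcases mul_eq_zero.mp h with h' | h'
    · rcases mul_eq_zero.mp h' with h'' | h''
      · exact absurd h'' hη1
      · exact absurd h'' hG
    · exact h'
  · intro h
    rw [h, mul_zero, mul_zero]

/-- **`𝓛^η` has only finitely many zeros among the wild characters** (rational newforms, ANY prime
`p`). Let `f ∈ S₂(Γ₀(N))` be a normalised newform with rational coefficients and `|aₙ| ≤ C n^θ`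
(`θ < 2/3`), `η` primitive mod `p^c` (`c ≥ 1`), `α ≠ 0`, `μ` with the D1 property. Then there is `n₀`
such that `∫_Γ ξ dμ ≠ 0` for EVERY primitive even `ξ` mod `pⁿ` of `p`-power order with `n ≥ n₀`:
write `ξ = τψ` for a `ℚ̄`-valued `ψ` (`exists_ringHomComp_eq_padic`); if `∫ ξ dμ = 0` then
`∑ ξ(a)[a/pⁿ]⁺_f = 0` (`gammaCharValue_eq_zero_iff`), hence (transport of the RATIONAL plus symbols)
`∑ (σψ)(a)[a/pⁿ]⁺_f = 0` over `ℂ`, so by Birch's formula (`ratTwistedSymbolSum_mul_plusPeriod_holds`,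
`τ(σψ) ≠ 0`) `L(f, (σψ)⁻¹, 1) = 0`: `(σψ)⁻¹` lies in the FINITE exceptional set of Rohrlich's theorem
at `p` (`rohrlich_primePow_of_coeffBound`, `p ∣ N` allowed), whose levels are bounded — impossible
for `pⁿ` large. [cite: RohrlichInventiones1984, Theorem (p. 409)] -/
theorem exists_forall_gammaCharValue_ne_zero_of_coeffBound (hμ : IsUntwistedPAdicLFunction p f η α μ)
    (hc : 0 < c) (hη : η.IsPrimitive) (hα : α ≠ 0) (hf : IsNewform0 f) (hQ : coeffField f = ⊥)
    {C θ : ℝ} (hC : 0 ≤ C) (hθ : 0 < θ) (hθ1 : θ < 2 / 3)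
    (ha : ∀ n : ℕ, ‖cuspCoeff f n‖ ≤ C * (n : ℝ) ^ θ) :
    ∃ n₀ : ℕ, ∀ n : ℕ, n₀ ≤ n → ∀ ξ : DirichletCharacter ℂ_[p] (p ^ n), ξ.IsPrimitive → ξ.Even →
      (∃ j : ℕ, orderOf ξ = p ^ j) → gammaCharValue p μ ξ ≠ 0 := by
  have hp : p.Prime := Fact.out
  -- the finite exceptional set and a bound for its levels
  have hfin := rohrlich_primePow_of_coeffBound (p := p) hf hQ hC hθ hθ1 ha
  obtain ⟨B, hB⟩ := (hfin.image Sigma.fst).bddAbove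
  refine ⟨max (2 * c) (B + 1), fun n hn ξ hξ hξe hξo hzero ↦ ?_⟩
  have h2c : 2 * c ≤ n := le_trans (le_max_left _ _) hn
  have hnB : B < p ^ n :=
    lt_of_lt_of_le (lt_of_lt_of_le (Nat.lt_succ_self B) (le_trans (le_max_right _ _) hn))
      (le_of_lt (Nat.lt_pow_self hp.one_lt))
  haveI : NeZero (p ^ n) := ⟨pow_ne_zero _ hp.ne_zero⟩
  -- `∑ ξ(a)[a/pⁿ]⁺_f = 0` over `ℂ_p`
  have hS : ratTwistedSymbolSum f ξ = 0 :=
    (gammaCharValue_eq_zero_iff hμ hc hη hα h2c ξ hξ hξe hξo).mp hzero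
  -- transport `ℂ_p ← ℚ̄ → ℂ`
  let K := AlgebraicClosure ℚ
  let σ : K →+* ℂ := (@IsAlgClosed.lift ℂ _ _ ℚ _ _ K _ _ (AlgebraicClosure.instAlgebra ℚ) _ _ _
    (AlgebraicClosure.isAlgebraic ℚ)).toRingHom
  let τ : K →+* ℂ_[p] := (@IsAlgClosed.lift ℂ_[p] _ _ ℚ _ _ K _ _
    (AlgebraicClosure.instAlgebra ℚ) _ _ _ (AlgebraicClosure.isAlgebraic ℚ)).toRingHom
  obtain ⟨ψ, hψ⟩ := exists_ringHomComp_eq_padic τ ξ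
  have hψprim : ψ.IsPrimitive := (isPrimitive_ringHomComp_iff τ ψ).mp (hψ ▸ hξ)
  have hψeven : ψ.Even := (even_ringHomComp_iff τ ψ).mp (hψ ▸ hξe)
  set χ : DirichletCharacter ℂ (p ^ n) := ψ.ringHomComp σ with hχdef
  have hχprim : χ.IsPrimitive := (isPrimitive_ringHomComp_iff σ ψ).mpr hψprim
  have hχeven : χ.Even := (even_ringHomComp_iff σ ψ).mpr hψeven
  have hSχ : ratTwistedSymbolSum f χ = 0 := by
    have hK : ratTwistedSymbolSum f ψ = 0 := by
      rw [← hψ, ratTwistedSymbolSum_ringHomComp, map_eq_zero] at hS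
      exact hS
    rw [hχdef, ratTwistedSymbolSum_ringHomComp, hK, map_zero]
  -- Birch: `L(f, χ⁻¹, 1) = 0`
  obtain ⟨L, hLd, hL⟩ := exists_differentiable_eq_twistedLSeries_holds f χ⁻¹
  have hBirch := ratTwistedSymbolSum_mul_plusPeriod_holds (f := f) hf hQ hχprim hχeven hLd hL
  rw [hSχ, zero_mul, eq_comm, mul_eq_zero] at hBirch
  have hL1 : L 1 = 0 := hBirch.resolve_left (gaussSum_stdAddChar_ne_zero hχprim)
  -- `χ⁻¹` is exceptional of level `pⁿ > B`
  have hinvprim : DirichletCharacter.IsPrimitive χ⁻¹ := by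
    rw [DirichletCharacter.isPrimitive_def, DirichletCharacter.conductor_inv]; exact hχprim
  have hmem : (⟨p ^ n, χ⁻¹⟩ : Σ m : ℕ, DirichletCharacter ℂ m) ∈
      {χ : Σ m : ℕ, DirichletCharacter ℂ m |
        χ.1 ≠ 0 ∧ χ.1.primeFactors ⊆ {p} ∧ χ.2.IsPrimitive ∧
          ∃ L : ℂ → ℂ, Differentiable ℂ L ∧
            (∀ s : ℂ, 2 < s.re → L s = twistedLSeries f χ.2 s) ∧ L 1 = 0} :=
    ⟨pow_ne_zero _ hp.ne_zero, (Nat.primeFactors_prime_pow (by omega) hp).le, hinvprim,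
      L, hLd, hL, hL1⟩
  have hle : p ^ n ≤ B := hB (Set.mem_image_of_mem Sigma.fst hmem)
  omega

/-- **The same for the newform of an elliptic curve `E/ℚ`, at ANY prime `p`** (Hasse bound
`θ = 5/8`): `IsUntwistedPAdicLFunction p f η α μ`, `η` primitive mod `p^c` (`c ≥ 1`), `α ≠ 0`,
`IsNewformOf W f` ⇒ `∫_Γ ξ dμ ≠ 0` for every wild `ξ` of conductor `pⁿ`, `n ≥ n₀`.
[cite: RohrlichInventiones1984, Theorem (p. 409)] -/
theorem exists_forall_gammaCharValue_ne_zero {W : WeierstrassCurve ℚ} [W.IsElliptic]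
    (hμ : IsUntwistedPAdicLFunction p f η α μ) (hc : 0 < c) (hη : η.IsPrimitive) (hα : α ≠ 0)
    (hf : IsNewformOf W f) :
    ∃ n₀ : ℕ, ∀ n : ℕ, n₀ ≤ n → ∀ ξ : DirichletCharacter ℂ_[p] (p ^ n), ξ.IsPrimitive → ξ.Even →
      (∃ j : ℕ, orderOf ξ = p ^ j) → gammaCharValue p μ ξ ≠ 0 :=
  exists_forall_gammaCharValue_ne_zero_of_coeffBound hμ hc hη hα hf.1 hf.coeffField_eq_bot
    (C := (16 : ℝ) ^ 256) (θ := 5 / 8) (by positivity) (by norm_num) (by norm_num)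
    (fun n ↦ by rw [hf.2 n]; exact W.norm_LFunction_le_rpow n)

end Values

/-- **The route's D1 object `𝓛^η_W` vanishes at only finitely many wild characters** (`p = 3`,
`η` primitive mod `9`, `α ≠ 0`): if `IsPSCyclotomicLFunctionOf W η α μ` then there is `n₀` with
`∫_Γ ξ dμ ≠ 0` for every primitive even `ξ` mod `3ⁿ` of `3`-power order, `n ≥ n₀` — i.e.
`𝓛^η_W(ξ) = (non-zero constant) · τ(ξ) L(E, ξ̄, 1)/Ω⁺_E ≠ 0` for all but finitely many `ξ`
(Rohrlich at `3 ∣ N`, unconditional). [cite: RohrlichInventiones1984, Theorem (p. 409)] -/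
theorem exists_forall_gammaCharValue_ne_zero_of_isPSCyclotomicLFunctionOf {W : WeierstrassCurve ℚ}
    [W.IsElliptic] {η' : DirichletCharacter ℂ_[3] (3 ^ 2)} {α : ℂ_[3]}
    {μ : (n : ℕ) → ZMod (3 ^ n) → ℂ_[3]}
    (hμ : IsPSCyclotomicLFunctionOf W η' α μ) (hη : η'.IsPrimitive) (hα : α ≠ 0) :
    ∃ n₀ : ℕ, ∀ n : ℕ, n₀ ≤ n → ∀ ξ : DirichletCharacter ℂ_[3] (3 ^ n), ξ.IsPrimitive → ξ.Even →
      (∃ j : ℕ, orderOf ξ = 3 ^ j) → gammaCharValue 3 μ ξ ≠ 0 := by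
  obtain ⟨N, hN, f, hf, hμf⟩ := hμ
  exact exists_forall_gammaCharValue_ne_zero hμf (by norm_num) hη hα hf

end Summit.BirchSwinnertonDyer.BirchSwinnertonDyer.Theorems.PSUntwistNonvanishingCofinite

end
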